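import Summits.QuantumFields.YangMills.Theorems.ColdStartUniversalityLatticeLangevinBakryEmeryCurvature
import HarnessLib

/-!
# Route `ColdStartUniversality` (fixed-cut-off package, Bakry–Émery side, GRADIENT half): pointwise calculus for the
# gradient bound — tangential frame derivatives, symmetry of `𝓛_(β')` on `C²` functions, Leibniz rule and frame dictionary

Helper file (seat `ym-line-csu-p1`, g29; `--supports stmt-QuantumFields-24809`).  Groundwork for the third leg of the Bakry–Émery
theorem at a fixed cut-off (after g25's Poincaré and g26's log-Sobolev halves): the weak gradient commutation
`Γ(P_t f) ≤ e^(−2ρt) P_t Γ(f)` for the SU(2) lattice Langevin (SZZ) semigroup.  With `coords`, the coordinate generator `gen = 𝓛_(β')`,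
the noise covariance `A` and the coordinate carré du champ `Γ^A(u,w)(V) = Σ_(ij) ∂_iu ∂_jw A_(ij)(V)` of the tree:
* §1 ★ `frameDeriv_eq_of_comp_coords_eq` — a frame derivative `W_n φ (coords V) = Dφ(coords V)[σ_n]` only sees the restriction of `φ`
  to the group (it is the derivative along the left flow `s ↦ e^(sX)·_e V`, `…WilsonFrameIBP`);
* §2 ★ `integral_mul_generator_symm_of_contDiff_two` — `∫ (g∘coords)·𝓛f dμ_(β') = ∫ (f∘coords)·𝓛g dμ_(β')` for `C²` `f, g`
  (no compact support; two integrations by parts along the noise frame);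
* §3 `generator_mul_coords` (Leibniz rule `𝓛(uw) = u𝓛w + w𝓛u + Γ^A(u,w)` on the group), `carre_eq_sum_frameDeriv_mul`
  (dictionary `Γ^A(u,w)(V) = Σ_n W_nu·W_nw (coords V)`);
(the pointwise curvature inequality built on these is the sequel `…GradientBoundCurvature`).
THEOREMS ONLY, no definition, no sorry.  HONEST FRAMING: fixed cut-off; pointwise calculus, no statement about the route's scaling
`β'_K → ∞`; nothing K-uniform; no crux, rung or summit statement is proved; the Yang–Mills mass gap is NOT proved.
-/

set_option autoImplicit false

noncomputable section

namespace Summit.QuantumFields.YangMills.Theorems.ColdStartUniversality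

open MeasureTheory Matrix Complex Finset
open scoped ComplexConjugate BigOperators Matrix
open Literature.MathematicalPhysics.QuantumFieldTheory
open Literature.MathematicalPhysics.QuantumLattice (fundamentalRep fundamentalLatticeRep continuous_fundamentalRep fundamentalRep_apply)

variable {L : ℕ} [NeZero L]

/-! ## §1. Frame derivatives are tangential -/

/-- ★ **A frame derivative only sees the group.**  If two differentiable functions of the real link coordinates agree at every
configuration of `SU(2)^E`, then their derivatives along every noise field `σ_n` agree there: `W_nφ₁(coords V) = W_nφ₂(coords V)`
(both are the derivative at `s = 0` of `s ↦ φ_i(coords(e^(sX)·_e V))`, `X = √2·𝐩(E_ν)`). [folklore] -/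
theorem frameDeriv_eq_of_comp_coords_eq (n : Edge 3 L × NoiseIdx (fundamentalLatticeRep 2).N)
    {φ₁ φ₂ : (Edge 3 L × Fin (fundamentalLatticeRep 2).N × Fin (fundamentalLatticeRep 2).N × Bool → ℝ) → ℝ} (h₁ : Differentiable ℝ φ₁) (h₂ : Differentiable ℝ φ₂)
    (heq : ∀ V : (GaugeConfig 3 L (Matrix.specialUnitaryGroup (Fin 2) ℂ)), φ₁ ((fun (V : GaugeConfig 3 L (Matrix.specialUnitaryGroup (Fin 2) ℂ)) (q : Edge 3 L × Fin (fundamentalLatticeRep 2).N × Fin (fundamentalLatticeRep 2).N × Bool) => (fun z : ℂ => if q.2.2.2 then z.im else z.re) ((fundamentalRep (Fin 2) (V q.1) : Matrix (Fin 2) (Fin 2) ℂ) q.2.1 q.2.2.1)) V) = φ₂ ((fun (V : GaugeConfig 3 L (Matrix.specialUnitaryGroup (Fin 2) ℂ)) (q : Edge 3 L × Fin (fundamentalLatticeRep 2).N × Fin (fundamentalLatticeRep 2).N × Bool) => (fun z : ℂ => if q.2.2.2 then z.im else z.re) ((fundamentalRep (Fin 2) (V q.1) : Matrix (Fin 2)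 (Fin 2) ℂ) q.2.1 q.2.2.1)) V)) (V : (GaugeConfig 3 L (Matrix.specialUnitaryGroup (Fin 2) ℂ))) :
    fderiv ℝ φ₁ ((fun (V : GaugeConfig 3 L (Matrix.specialUnitaryGroup (Fin 2) ℂ)) (q : Edge 3 L × Fin (fundamentalLatticeRep 2).N × Fin (fundamentalLatticeRep 2).N × Bool) => (fun z : ℂ => if q.2.2.2 then z.im else z.re) ((fundamentalRep (Fin 2) (V q.1) : Matrix (Fin 2) (Fin 2) ℂ) q.2.1 q.2.2.1)) V) (fun q : Edge 3 L × Fin (fundamentalLatticeRep 2).N × Fin (fundamentalLatticeRep 2).N × Bool => if n.1 = q.1 then (fun z : ℂ => if q.2.2.2 then z.im else z.re) (((Real.sqrt 2 : ℂ) • ((fundamentalLatticeRep 2).lieProj (noiseDir n.2) * (fun (ee : Edge 3 L) => Matrix.of fun (i j : Fin (fundamentalLatticeRep 2).N) => (((fun (V : GaugeConfig 3 L (Matrix.specialUnitaryGroup (Fin 2) ℂ)) (q : Edge 3 L × Fin (fundamentalLatticeRep 2).N × Fin (fundamentalLatticeRep 2).N × Bool) => (fun z : ℂ => if q.2.2.2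 then z.im else z.re) ((fundamentalRep (Fin 2) (V q.1) : Matrix (Fin 2) (Fin 2) ℂ) q.2.1 q.2.2.1)) V (ee, i, j, false) : ℝ) : ℂ) + (((fun (V : GaugeConfig 3 L (Matrix.specialUnitaryGroup (Fin 2) ℂ)) (q : Edge 3 L × Fin (fundamentalLatticeRep 2).N × Fin (fundamentalLatticeRep 2).N × Bool) => (fun z : ℂ => if q.2.2.2 then z.im else z.re) ((fundamentalRep (Fin 2) (V q.1) : Matrix (Fin 2) (Fin 2) ℂ) q.2.1 q.2.2.1)) V (ee, i, j, true) : ℝ) : ℂ) * Complex.I) q.1)) q.2.1 q.2.2.1) else 0) = fderiv ℝ φ₂ ((fun (V : GaugeConfig 3 L (Matrix.specialUnitaryGroup (Fin 2) ℂ)) (q : Edge 3 L × Fin (fundamentalLatticeRep 2).N × Fin (fundamentalLatticeRep 2).N × Bool) => (fun z : ℂ => if q.2.2.2 then z.im else z.re) ((fundamentalRep (Fin 2) (V q.1) : Matrix (Fin 2) (Fin 2) ℂ) q.2.1 q.2.2.1)) V) (fun q : Edge 3 L × Fin (fundamentalLatticeRep 2).N × Fin (fundamentalLatticeRep 2).N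 × Bool => if n.1 = q.1 then (fun z : ℂ => if q.2.2.2 then z.im else z.re) (((Real.sqrt 2 : ℂ) • ((fundamentalLatticeRep 2).lieProj (noiseDir n.2) * (fun (ee : Edge 3 L) => Matrix.of fun (i j : Fin (fundamentalLatticeRep 2).N) => (((fun (V : GaugeConfig 3 L (Matrix.specialUnitaryGroup (Fin 2) ℂ)) (q : Edge 3 L × Fin (fundamentalLatticeRep 2).N × Fin (fundamentalLatticeRep 2).N × Bool) => (fun z : ℂ => if q.2.2.2 then z.im else z.re) ((fundamentalRep (Fin 2) (V q.1) : Matrix (Fin 2) (Fin 2) ℂ) q.2.1 q.2.2.1)) V (ee, i, j, false) : ℝ) : ℂ) + (((fun (V : GaugeConfig 3 L (Matrix.specialUnitaryGroup (Fin 2) ℂ)) (q : Edge 3 L × Fin (fundamentalLatticeRep 2).N × Fin (fundamentalLatticeRep 2).N × Bool) => (fun z : ℂ => if q.2.2.2 then z.im else z.re) ((fundamentalRep (Fin 2) (V q.1) : Matrix (Fin 2) (Fin 2) ℂ) q.2.1 q.2.2.1)) V (ee, i, j, true) : ℝ) : ℂ) * Complex.I) q.1)) q.2.1 q.2.2.1)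 else 0) := by
  classical
  set co : (GaugeConfig 3 L (Matrix.specialUnitaryGroup (Fin 2) ℂ)) → (Edge 3 L × Fin (fundamentalLatticeRep 2).N × Fin (fundamentalLatticeRep 2).N × Bool → ℝ) := (fun (V : GaugeConfig 3 L (Matrix.specialUnitaryGroup (Fin 2) ℂ)) (q : Edge 3 L × Fin (fundamentalLatticeRep 2).N × Fin (fundamentalLatticeRep 2).N × Bool) => (fun z : ℂ => if q.2.2.2 then z.im else z.re) ((fundamentalRep (Fin 2) (V q.1) : Matrix (Fin 2) (Fin 2) ℂ) q.2.1 q.2.2.1)) with hco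
  set X : Matrix (Fin (fundamentalLatticeRep 2).N) (Fin (fundamentalLatticeRep 2).N) ℂ := (Real.sqrt 2 : ℂ) • (fundamentalLatticeRep 2).lieProj (noiseDir n.2) with hXdef
  have hX : Xᴴ = -X := by
    rw [hXdef, Matrix.conjTranspose_smul, ← Matrix.star_eq_conjTranspose, (fundamentalLatticeRep 2).star_lieProj, Complex.star_def,
      Complex.conj_ofReal, smul_neg]
  have hX0 : X.trace = 0 := by
    rw [hXdef, Matrix.trace_smul, trace_eq_zero_of_mem_lieAlg_two ((fundamentalLatticeRep 2).lieProj_mem (noiseDir n.2)), smul_zero]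
  have hd1 := hasDerivAt_comp_coords_leftFlow (L := L) hX hX0 n.1 V h₁ 0
  have hd2 := hasDerivAt_comp_coords_leftFlow (L := L) hX hX0 n.1 V h₂ 0
  have hu0 : Pi.mulSingle n.1 (SUNBakryEmery.expSU (N := 2) (Y := Matrix.of fun i j : Fin 2 => X i j) hX hX0 (0 : ℝ)) * V = V := by
    have : (SUNBakryEmery.expSU (N := 2) (Y := Matrix.of fun i j : Fin 2 => X i j) hX hX0 (0 : ℝ)) = 1 :=
      Subtype.ext (by rw [SUNBakryEmery.coe_expSU, zero_smul, NormedSpace.exp_zero]; rfl)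
    rw [this, Pi.mulSingle_one, one_mul]
  have hd1' := hd1.congr_of_eventuallyEq (Filter.Eventually.of_forall fun s => (heq _).symm)
  have h := hd1'.unique hd2
  simp only [hu0] at h
  have hσX : (fun q : Edge 3 L × Fin (fundamentalLatticeRep 2).N × Fin (fundamentalLatticeRep 2).N × Bool => if n.1 = q.1 then (fun z : ℂ => if q.2.2.2 then z.im else z.re) (((Real.sqrt 2 : ℂ) • ((fundamentalLatticeRep 2).lieProj (noiseDir n.2) * (fun (ee : Edge 3 L) => Matrix.of fun (i j : Fin (fundamentalLatticeRep 2).N) => (((fun (V : GaugeConfig 3 L (Matrix.specialUnitaryGroup (Fin 2) ℂ)) (q : Edge 3 L × Fin (fundamentalLatticeRep 2).N × Fin (fundamentalLatticeRep 2).N × Bool) => (fun z : ℂ => if q.2.2.2 then z.im else z.re) ((fundamentalRep (Fin 2) (V q.1) : Matrix (Fin 2) (Fin 2) ℂ) q.2.1 q.2.2.1)) V (ee, i, j, false) : ℝ) : ℂ) + (((fun (V : GaugeConfig 3 L (Matrix.specialUnitaryGroup (Fin 2) ℂ)) (q : Edge 3 L × Fin (fundamentalLatticeRep 2).N × Fin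 (fundamentalLatticeRep 2).N × Bool) => (fun z : ℂ => if q.2.2.2 then z.im else z.re) ((fundamentalRep (Fin 2) (V q.1) : Matrix (Fin 2) (Fin 2) ℂ) q.2.1 q.2.2.1)) V (ee, i, j, true) : ℝ) : ℂ) * Complex.I) q.1)) q.2.1 q.2.2.1) else 0) = (fun q : Edge 3 L × Fin (fundamentalLatticeRep 2).N × Fin (fundamentalLatticeRep 2).N × Bool => if n.1 = q.1 then (fun z : ℂ => if q.2.2.2 then z.im else z.re) ((X * (fun (ee : Edge 3 L) => Matrix.of fun (i j : Fin (fundamentalLatticeRep 2).N) => (((fun (V : GaugeConfig 3 L (Matrix.specialUnitaryGroup (Fin 2) ℂ)) (q : Edge 3 L × Fin (fundamentalLatticeRep 2).N × Fin (fundamentalLatticeRep 2).N × Bool) => (fun z : ℂ => if q.2.2.2 then z.im else z.re) ((fundamentalRep (Fin 2) (V q.1) : Matrix (Fin 2) (Fin 2) ℂ) q.2.1 q.2.2.1)) V (ee, i, j, false) : ℝ) : ℂ) + (((fun (V : GaugeConfig 3 L (Matrix.specialUnitaryGroup (Fin 2) ℂ)) (q : Edge 3 L × Fin (fundamentalLatticeRep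 2).N × Fin (fundamentalLatticeRep 2).N × Bool) => (fun z : ℂ => if q.2.2.2 then z.im else z.re) ((fundamentalRep (Fin 2) (V q.1) : Matrix (Fin 2) (Fin 2) ℂ) q.2.1 q.2.2.1)) V (ee, i, j, true) : ℝ) : ℂ) * Complex.I) q.1) q.2.1 q.2.2.1) else 0) := by
    funext q; simp only [hXdef, Matrix.smul_mul]
  rw [hσX]
  exact h

/-! ## §2. Symmetry of the generator on `C²` functions -/

/-- ★ **`𝓛_(β')` is symmetric on `C²` cylinder functions**: `∫ (g∘coords)·𝓛f dμ_(β') = ∫ (f∘coords)·𝓛g dμ_(β')` for all `C²`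
functions `f, g` of the real link coordinates — both sides equal `−½ Σ_n ∫ W_nf·W_ng dμ_(β')` by one integration by parts along the
noise frame (`integral_frameDeriv_mul_wilson`) and `𝓛 = ½Σ_n(W_n² + W_nψ̂·W_n)` (`generator_eq_half_frameGen`).  (The tree's
`integral_mul_generator_symm` asks `C³` and compact support.) [cite: ShenZhuZhu2022, §3 (𝓔^L(F,G) = -∫ 𝓛_L F G dμ, p. 13)] -/
theorem integral_mul_generator_symm_of_contDiff_two (L : ℕ) [NeZero L] (β' : ℝ)
    {f g : (Edge 3 L × Fin 2 × Fin 2 × Bool → ℝ) → ℝ} (hf : ContDiff ℝ 2 f) (hg : ContDiff ℝ 2 g) :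
    let coords : GaugeConfig 3 L (Matrix.specialUnitaryGroup (Fin 2) ℂ) → (Edge 3 L × Fin 2 × Fin 2 × Bool → ℝ) :=
      fun V q => (fun z : ℂ => if q.2.2.2 then z.im else z.re)
        ((fundamentalRep (Fin 2) (V q.1) : Matrix (Fin 2) (Fin 2) ℂ) q.2.1 q.2.2.1)
    let gen : ((Edge 3 L × Fin 2 × Fin 2 × Bool → ℝ) → ℝ) → GaugeConfig 3 L (Matrix.specialUnitaryGroup (Fin 2) ℂ) → ℝ :=
      fun h V =>
      (∑ i : Edge 3 L × Fin 2 × Fin 2 × Bool, fderiv ℝ h (coords V) (Pi.single i 1) *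
          (fun z : ℂ => if i.2.2.2 then z.im else z.re)
            ((latticeLangevinDynamics (fundamentalLatticeRep 2) β').drift
              (matrixConfig (fundamentalRep (Fin 2)) V) i.1 i.2.1 i.2.2.1) +
      1 / 2 * ∑ i : Edge 3 L × Fin 2 × Fin 2 × Bool, ∑ j : Edge 3 L × Fin 2 × Fin 2 × Bool,
        fderiv ℝ (fun z => fderiv ℝ h z (Pi.single i 1)) (coords V) (Pi.single j 1) *
          ∑ n : Edge 3 L × NoiseIdx 2,
            (if n.1 = i.1 then (fun z : ℂ => if i.2.2.2 then z.im else z.re)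
              ((latticeLangevinDynamics (fundamentalLatticeRep 2) β').noise
                (matrixConfig (fundamentalRep (Fin 2)) V) i.1 n.2 i.2.1 i.2.2.1) else 0) *
            (if n.1 = j.1 then (fun z : ℂ => if j.2.2.2 then z.im else z.re)
              ((latticeLangevinDynamics (fundamentalLatticeRep 2) β').noise
                (matrixConfig (fundamentalRep (Fin 2)) V) j.1 n.2 j.2.1 j.2.2.1) else 0))
    ∫ V, g (coords V) * gen f V ∂(wilsonMeasure (d := 3) (L := L) (fundamentalRep (Fin 2)) β') = ∫ V, f (coords V) * gen g V ∂(wilsonMeasure (d := 3) (L := L) (fundamentalRep (Fin 2)) β') := by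
  intro coords gen
  classical
  haveI := secondCountableTopology_su2
  haveI := borelSpace_config L
  set μ : Measure (GaugeConfig 3 L (Matrix.specialUnitaryGroup (Fin 2) ℂ)) := (wilsonMeasure (d := 3) (L := L) (fundamentalRep (Fin 2)) β') with hμ
  haveI : IsProbabilityMeasure μ :=
    isProbabilityMeasure_wilsonMeasure (d := 3) (L := L) (fundamentalRep (Fin 2)) (continuous_fundamentalRep (Fin 2)) β'
  obtain ⟨s, c, hs, -, -, -, hCas⟩ := exists_noiseFrame L
  set s2 : (Edge 3 L × NoiseIdx (fundamentalLatticeRep 2).N) → ((Edge 3 L × Fin 2 × Fin 2 × Bool → ℝ) →L[ℝ] (Edge 3 L × Fin 2 × Fin 2 × Bool → ℝ)) := s with hs2def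
  set ψ : (Edge 3 L × Fin 2 × Fin 2 × Bool → ℝ) → ℝ := (fun y : (Edge 3 L × Fin 2 × Fin 2 × Bool → ℝ) => β' * ∑ p : Plaquette 3 L, (rootedLoop (fun (ee : Edge 3 L) (i j : Fin 2) => ((y (ee, i, j, false) : ℝ) : ℂ) + ((y (ee, i, j, true) : ℝ) : ℂ) * Complex.I) (p.1, p.2.1.1) p.2.1.2 false).trace.re) with hψ
  have hψC : ContDiff ℝ 2 ψ := (contDiff_psiHat (d := 3) (L := L) (N := (fundamentalLatticeRep 2).N) β').of_le le_top
  have hco : Continuous coords := continuous_coords (L := L)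
  have hint : ∀ F : (Edge 3 L × Fin 2 × Fin 2 × Bool → ℝ) → ℝ, Continuous F → Integrable (fun V => F (coords V)) μ := fun F hF =>
    (hF.comp hco).integrable_of_hasCompactSupport (HasCompactSupport.of_compactSpace _)
  -- integration by parts along the frame
  have hIBP : ∀ (n : Edge 3 L × NoiseIdx (fundamentalLatticeRep 2).N) (A B : (Edge 3 L × Fin 2 × Fin 2 × Bool → ℝ) → ℝ), ContDiff ℝ 1 A → ContDiff ℝ 1 B →
      ∫ V, fderiv ℝ A (coords V) (s2 n (coords V)) * B (coords V) ∂μ =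
        -∫ V, A (coords V) * fderiv ℝ B (coords V) (s2 n (coords V)) ∂μ -
          ∫ V, A (coords V) * B (coords V) * fderiv ℝ ψ (coords V) (s2 n (coords V)) ∂μ := by
    intro n A B hA hB
    have h := integral_frameDeriv_mul_wilson L β' n (A := A) (B := B) hA hB
    have hsn : ∀ V : (GaugeConfig 3 L (Matrix.specialUnitaryGroup (Fin 2) ℂ)), s2 n (coords V) = (fun q : Edge 3 L × Fin (fundamentalLatticeRep 2).N × Fin (fundamentalLatticeRep 2).N × Bool => if n.1 = q.1 then (fun z : ℂ => if q.2.2.2 then z.im else z.re) (((Real.sqrt 2 : ℂ) • ((fundamentalLatticeRep 2).lieProj (noiseDir n.2) * (fun (ee : Edge 3 L) => Matrix.of fun (i j : Fin (fundamentalLatticeRep 2).N) => ((coords V (ee, i, j, false) : ℝ) : ℂ) + ((coords V (ee, i, j, true) : ℝ) : ℂ) * Complex.I) q.1)) q.2.1 q.2.2.1) else 0) := fun V => hs n (coords V)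
    simp_rw [hsn]
    exact h
  -- the generator in frame form
  have hD : ∀ φ : (Edge 3 L × Fin 2 × Fin 2 × Bool → ℝ) → ℝ, ContDiff ℝ 2 φ → ∀ V : (GaugeConfig 3 L (Matrix.specialUnitaryGroup (Fin 2) ℂ)), gen φ V = 1 / 2 * ∑ n : Edge 3 L × NoiseIdx (fundamentalLatticeRep 2).N,
      (fderiv ℝ (fun w => fderiv ℝ φ w (s2 n w)) (coords V) (s2 n (coords V)) +
        fderiv ℝ ψ (coords V) (s2 n (coords V)) * fderiv ℝ φ (coords V) (s2 n (coords V))) :=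
    fun φ hφ V => generator_eq_half_frameGen L β' s hs hCas φ hφ V
  -- `∫ χ 𝓛φ = −½ Σ_n ∫ W_nχ W_nφ`
  have key : ∀ φ χ : (Edge 3 L × Fin 2 × Fin 2 × Bool → ℝ) → ℝ, ContDiff ℝ 2 φ → ContDiff ℝ 2 χ →
      ∫ V, χ (coords V) * gen φ V ∂μ = -(1 / 2) * ∑ n : Edge 3 L × NoiseIdx (fundamentalLatticeRep 2).N,
        ∫ V, fderiv ℝ χ (coords V) (s2 n (coords V)) * fderiv ℝ φ (coords V) (s2 n (coords V)) ∂μ := by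
    intro φ χ hφ hχ
    have hφ1 : ContDiff ℝ 1 φ := hφ.of_le (by norm_num)
    have hχ1 : ContDiff ℝ 1 χ := hχ.of_le (by norm_num)
    have cW : ∀ n, Continuous (fun z => fderiv ℝ φ z (s2 n z)) := fun n => (contDiff_frameDeriv (k := 1) hφ (s2 n)).continuous
    have cWχ : ∀ n, Continuous (fun z => fderiv ℝ χ z (s2 n z)) := fun n => (contDiff_frameDeriv (k := 1) hχ (s2 n)).continuous
    have cWW : ∀ n, Continuous (fun z => fderiv ℝ (fun w => fderiv ℝ φ w (s2 n w)) z (s2 n z)) := fun n =>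
      (contDiff_frameDeriv (k := 0) (contDiff_frameDeriv (k := 1) hφ (s2 n)) (s2 n)).continuous
    have cWψ : ∀ n, Continuous (fun z => fderiv ℝ ψ z (s2 n z)) := fun n => (contDiff_frameDeriv (k := 1) hψC (s2 n)).continuous
    have hptw : ∀ V : (GaugeConfig 3 L (Matrix.specialUnitaryGroup (Fin 2) ℂ)), χ (coords V) * gen φ V = 1 / 2 * ∑ n : Edge 3 L × NoiseIdx (fundamentalLatticeRep 2).N,
        (χ (coords V) * fderiv ℝ (fun w => fderiv ℝ φ w (s2 n w)) (coords V) (s2 n (coords V)) +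
          χ (coords V) * fderiv ℝ φ (coords V) (s2 n (coords V)) * fderiv ℝ ψ (coords V) (s2 n (coords V))) := by
      intro V
      rw [hD φ hφ V]
      have hS : ∑ n : Edge 3 L × NoiseIdx (fundamentalLatticeRep 2).N,
          (χ (coords V) * fderiv ℝ (fun w => fderiv ℝ φ w (s2 n w)) (coords V) (s2 n (coords V)) +
            χ (coords V) * fderiv ℝ φ (coords V) (s2 n (coords V)) * fderiv ℝ ψ (coords V) (s2 n (coords V))) =
          χ (coords V) * ∑ n : Edge 3 L × NoiseIdx (fundamentalLatticeRep 2).N,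
            (fderiv ℝ (fun w => fderiv ℝ φ w (s2 n w)) (coords V) (s2 n (coords V)) +
              fderiv ℝ ψ (coords V) (s2 n (coords V)) * fderiv ℝ φ (coords V) (s2 n (coords V))) := by
        rw [Finset.mul_sum]
        exact Finset.sum_congr rfl fun n _ => by ring
      rw [hS]
      ring
    have hI1 : ∀ n : Edge 3 L × NoiseIdx (fundamentalLatticeRep 2).N, Integrable (fun V => χ (coords V) * fderiv ℝ (fun w => fderiv ℝ φ w (s2 n w)) (coords V) (s2 n (coords V))) μ :=
      fun n => hint (fun z => χ z * fderiv ℝ (fun w => fderiv ℝ φ w (s2 n w)) z (s2 n z)) (hχ.continuous.mul (cWW n))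
    have hI2 : ∀ n : Edge 3 L × NoiseIdx (fundamentalLatticeRep 2).N, Integrable (fun V => χ (coords V) * fderiv ℝ φ (coords V) (s2 n (coords V)) * fderiv ℝ ψ (coords V) (s2 n (coords V))) μ :=
      fun n => hint (fun z => χ z * fderiv ℝ φ z (s2 n z) * fderiv ℝ ψ z (s2 n z)) ((hχ.continuous.mul (cW n)).mul (cWψ n))
    have hI12 : ∀ n : Edge 3 L × NoiseIdx (fundamentalLatticeRep 2).N, Integrable (fun V => χ (coords V) * fderiv ℝ (fun w => fderiv ℝ φ w (s2 n w)) (coords V) (s2 n (coords V)) +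
          χ (coords V) * fderiv ℝ φ (coords V) (s2 n (coords V)) * fderiv ℝ ψ (coords V) (s2 n (coords V))) μ :=
      fun n => (hI1 n).add (hI2 n)
    have h1 : ∫ V, χ (coords V) * gen φ V ∂μ = 1 / 2 * ∑ n : Edge 3 L × NoiseIdx (fundamentalLatticeRep 2).N,
        ∫ V, (χ (coords V) * fderiv ℝ (fun w => fderiv ℝ φ w (s2 n w)) (coords V) (s2 n (coords V)) +
          χ (coords V) * fderiv ℝ φ (coords V) (s2 n (coords V)) * fderiv ℝ ψ (coords V) (s2 n (coords V))) ∂μ := by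
      rw [← integral_finsetSum _ fun n _ => hI12 n, ← integral_const_mul]
      exact integral_congr_ae (Filter.Eventually.of_forall hptw)
    rw [h1, Finset.mul_sum, Finset.mul_sum]
    refine Finset.sum_congr rfl fun n _ => ?_
    have hW1 : ContDiff ℝ 1 (fun w => fderiv ℝ φ w (s2 n w)) := contDiff_frameDeriv (k := 1) hφ (s2 n)
    have h2 := hIBP n (fun w => fderiv ℝ φ w (s2 n w)) χ hW1 hχ1
    rw [integral_add (hI1 n) (hI2 n)]
    have e1 : ∫ V, χ (coords V) * fderiv ℝ (fun w => fderiv ℝ φ w (s2 n w)) (coords V) (s2 n (coords V)) ∂μ =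
        ∫ V, fderiv ℝ (fun w => fderiv ℝ φ w (s2 n w)) (coords V) (s2 n (coords V)) * χ (coords V) ∂μ :=
      integral_congr_ae (Filter.Eventually.of_forall fun V => mul_comm _ _)
    have e2 : ∫ V, χ (coords V) * fderiv ℝ φ (coords V) (s2 n (coords V)) * fderiv ℝ ψ (coords V) (s2 n (coords V)) ∂μ =
        ∫ V, fderiv ℝ φ (coords V) (s2 n (coords V)) * χ (coords V) * fderiv ℝ ψ (coords V) (s2 n (coords V)) ∂μ :=
      integral_congr_ae (Filter.Eventually.of_forall fun V => by ring)
    have e3 : ∫ V, fderiv ℝ φ (coords V) (s2 n (coords V)) * fderiv ℝ χ (coords V) (s2 n (coords V)) ∂μ =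
        ∫ V, fderiv ℝ χ (coords V) (s2 n (coords V)) * fderiv ℝ φ (coords V) (s2 n (coords V)) ∂μ :=
      integral_congr_ae (Filter.Eventually.of_forall fun V => mul_comm _ _)
    rw [e1, h2, e2, ← e3]
    ring
  rw [key f g hf hg, key g f hg hf]
  congr 1
  exact Finset.sum_congr rfl fun n _ => integral_congr_ae (Filter.Eventually.of_forall fun V => mul_comm _ _)

/-! ## §3. Leibniz rule and the frame dictionary for the coordinate carré du champ -/

/-- **Leibniz rule for `𝓛_(β')` on the group**: `𝓛(uw)(V) = u·𝓛w(V) + w·𝓛u(V) + Γ^A(u,w)(V)` for `C²` functions `u, w` of the real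
link coordinates (`generator_mul` with the symmetric noise covariance `A`). [folklore] -/
theorem generator_mul_coords (L : ℕ) [NeZero L] (β' : ℝ) {u w : (Edge 3 L × Fin 2 × Fin 2 × Bool → ℝ) → ℝ} (hu : ContDiff ℝ 2 u) (hw : ContDiff ℝ 2 w) (V : (GaugeConfig 3 L (Matrix.specialUnitaryGroup (Fin 2) ℂ))) :
    let coords : GaugeConfig 3 L (Matrix.specialUnitaryGroup (Fin 2) ℂ) → (Edge 3 L × Fin 2 × Fin 2 × Bool → ℝ) :=
      fun V q => (fun z : ℂ => if q.2.2.2 then z.im else z.re)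
        ((fundamentalRep (Fin 2) (V q.1) : Matrix (Fin 2) (Fin 2) ℂ) q.2.1 q.2.2.1)
    let A : GaugeConfig 3 L (Matrix.specialUnitaryGroup (Fin 2) ℂ) → (Edge 3 L × Fin 2 × Fin 2 × Bool) →
        (Edge 3 L × Fin 2 × Fin 2 × Bool) → ℝ := fun V i j =>
      ∑ n : Edge 3 L × NoiseIdx 2,
        (if n.1 = i.1 then (fun z : ℂ => if i.2.2.2 then z.im else z.re)
          ((latticeLangevinDynamics (fundamentalLatticeRep 2) β').noise
            (matrixConfig (fundamentalRep (Fin 2)) V) i.1 n.2 i.2.1 i.2.2.1) else 0) *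
        (if n.1 = j.1 then (fun z : ℂ => if j.2.2.2 then z.im else z.re)
          ((latticeLangevinDynamics (fundamentalLatticeRep 2) β').noise
            (matrixConfig (fundamentalRep (Fin 2)) V) j.1 n.2 j.2.1 j.2.2.1) else 0)
    let gen : ((Edge 3 L × Fin 2 × Fin 2 × Bool → ℝ) → ℝ) → GaugeConfig 3 L (Matrix.specialUnitaryGroup (Fin 2) ℂ) → ℝ :=
      fun h V =>
      (∑ i : Edge 3 L × Fin 2 × Fin 2 × Bool, fderiv ℝ h (coords V) (Pi.single i 1) *
          (fun z : ℂ => if i.2.2.2 then z.im else z.re)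
            ((latticeLangevinDynamics (fundamentalLatticeRep 2) β').drift
              (matrixConfig (fundamentalRep (Fin 2)) V) i.1 i.2.1 i.2.2.1) +
      1 / 2 * ∑ i : Edge 3 L × Fin 2 × Fin 2 × Bool, ∑ j : Edge 3 L × Fin 2 × Fin 2 × Bool,
        fderiv ℝ (fun z => fderiv ℝ h z (Pi.single i 1)) (coords V) (Pi.single j 1) *
          ∑ n : Edge 3 L × NoiseIdx 2,
            (if n.1 = i.1 then (fun z : ℂ => if i.2.2.2 then z.im else z.re)
              ((latticeLangevinDynamics (fundamentalLatticeRep 2) β').noise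
                (matrixConfig (fundamentalRep (Fin 2)) V) i.1 n.2 i.2.1 i.2.2.1) else 0) *
            (if n.1 = j.1 then (fun z : ℂ => if j.2.2.2 then z.im else z.re)
              ((latticeLangevinDynamics (fundamentalLatticeRep 2) β').noise
                (matrixConfig (fundamentalRep (Fin 2)) V) j.1 n.2 j.2.1 j.2.2.1) else 0))
    gen (fun z => u z * w z) V = u (coords V) * gen w V + w (coords V) * gen u V +
      ∑ i : Edge 3 L × Fin 2 × Fin 2 × Bool, ∑ j : Edge 3 L × Fin 2 × Fin 2 × Bool,
        fderiv ℝ u (coords V) (Pi.single i 1) * fderiv ℝ w (coords V) (Pi.single j 1) * A V i j := by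
  intro coords A gen
  classical
  set b : (GaugeConfig 3 L (Matrix.specialUnitaryGroup (Fin 2) ℂ)) → (Edge 3 L × Fin 2 × Fin 2 × Bool) → ℝ := fun V i =>
      (fun z : ℂ => if i.2.2.2 then z.im else z.re)
        ((latticeLangevinDynamics (fundamentalLatticeRep 2) β').drift (matrixConfig (fundamentalRep (Fin 2)) V) i.1 i.2.1 i.2.2.1) with hb
  have hA : ∀ i j, A V i j = A V j i := fun i j => Finset.sum_congr rfl fun n _ => mul_comm _ _
  have h := generator_mul (fun i : Edge 3 L × Fin 2 × Fin 2 × Bool => (Pi.single i (1 : ℝ) : _ → ℝ)) (b V) (A V) hA hu hw (coords V)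
  show (∑ i, fderiv ℝ (fun z => u z * w z) (coords V) (Pi.single i 1) * b V i +
      1 / 2 * ∑ i, ∑ j, fderiv ℝ (fun z => fderiv ℝ (fun z' => u z' * w z') z (Pi.single i 1)) (coords V) (Pi.single j 1) * A V i j) =
    u (coords V) * (∑ i, fderiv ℝ w (coords V) (Pi.single i 1) * b V i +
      1 / 2 * ∑ i, ∑ j, fderiv ℝ (fun z => fderiv ℝ w z (Pi.single i 1)) (coords V) (Pi.single j 1) * A V i j) +
    w (coords V) * (∑ i, fderiv ℝ u (coords V) (Pi.single i 1) * b V i +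
      1 / 2 * ∑ i, ∑ j, fderiv ℝ (fun z => fderiv ℝ u z (Pi.single i 1)) (coords V) (Pi.single j 1) * A V i j) +
    ∑ i, ∑ j, fderiv ℝ u (coords V) (Pi.single i 1) * fderiv ℝ w (coords V) (Pi.single j 1) * A V i j
  rw [h]

/-- `Σ_(ij) a_i c_j (Σ_n σ_in σ_jn) = Σ_n (Σ_i a_i σ_in)(Σ_j c_j σ_jn)`. [folklore] -/
theorem sum_sum_mul_mul_noiseCov_eq_sum_mul {ι κ : Type*} [Fintype ι] [Fintype κ] (a c : ι → ℝ) (σ : ι → κ → ℝ) :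
    ∑ i, ∑ j, a i * c j * ∑ n, σ i n * σ j n = ∑ n, (∑ i, a i * σ i n) * (∑ j, c j * σ j n) := by
  calc ∑ i, ∑ j, a i * c j * ∑ n, σ i n * σ j n = ∑ i, ∑ j, ∑ n, (a i * σ i n) * (c j * σ j n) := by
        refine sum_congr rfl fun i _ => sum_congr rfl fun j _ => ?_
        rw [mul_sum]; exact sum_congr rfl fun n _ => by ring
    _ = ∑ i, ∑ n, ∑ j, (a i * σ i n) * (c j * σ j n) := sum_congr rfl fun i _ => Finset.sum_comm
    _ = ∑ n, ∑ i, ∑ j, (a i * σ i n) * (c j * σ j n) := Finset.sum_comm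
    _ = ∑ n, (∑ i, a i * σ i n) * (∑ j, c j * σ j n) := by
        refine sum_congr rfl fun n _ => ?_
        rw [sum_mul_sum]

/-- **Frame dictionary for the (bilinear) coordinate carré du champ**: `Γ^A(u,w)(V) = Σ_n W_nu·W_nw (coords V)`, `W_nφ = Dφ[σ_n]`,
for differentiable `u, w`. [cite: ShenZhuZhu2022, §3 Lemma 3.1 and (1.6)] -/
theorem carre_eq_sum_frameDeriv_mul (L : ℕ) [NeZero L] (β' : ℝ) (u w : (Edge 3 L × Fin 2 × Fin 2 × Bool → ℝ) → ℝ) (V : (GaugeConfig 3 L (Matrix.specialUnitaryGroup (Fin 2) ℂ))) :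
    let coords : GaugeConfig 3 L (Matrix.specialUnitaryGroup (Fin 2) ℂ) → (Edge 3 L × Fin 2 × Fin 2 × Bool → ℝ) :=
      fun V q => (fun z : ℂ => if q.2.2.2 then z.im else z.re)
        ((fundamentalRep (Fin 2) (V q.1) : Matrix (Fin 2) (Fin 2) ℂ) q.2.1 q.2.2.1)
    let A : GaugeConfig 3 L (Matrix.specialUnitaryGroup (Fin 2) ℂ) → (Edge 3 L × Fin 2 × Fin 2 × Bool) →
        (Edge 3 L × Fin 2 × Fin 2 × Bool) → ℝ := fun V i j =>
      ∑ n : Edge 3 L × NoiseIdx 2,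
        (if n.1 = i.1 then (fun z : ℂ => if i.2.2.2 then z.im else z.re)
          ((latticeLangevinDynamics (fundamentalLatticeRep 2) β').noise
            (matrixConfig (fundamentalRep (Fin 2)) V) i.1 n.2 i.2.1 i.2.2.1) else 0) *
        (if n.1 = j.1 then (fun z : ℂ => if j.2.2.2 then z.im else z.re)
          ((latticeLangevinDynamics (fundamentalLatticeRep 2) β').noise
            (matrixConfig (fundamentalRep (Fin 2)) V) j.1 n.2 j.2.1 j.2.2.1) else 0)
    ∑ i : Edge 3 L × Fin 2 × Fin 2 × Bool, ∑ j : Edge 3 L × Fin 2 × Fin 2 × Bool,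
        fderiv ℝ u (coords V) (Pi.single i 1) * fderiv ℝ w (coords V) (Pi.single j 1) * A V i j =
      ∑ n : Edge 3 L × NoiseIdx (fundamentalLatticeRep 2).N,
        fderiv ℝ u (coords V) (fun q : Edge 3 L × Fin (fundamentalLatticeRep 2).N × Fin (fundamentalLatticeRep 2).N × Bool => if n.1 = q.1 then (fun z : ℂ => if q.2.2.2 then z.im else z.re) (((Real.sqrt 2 : ℂ) • ((fundamentalLatticeRep 2).lieProj (noiseDir n.2) * (fun (ee : Edge 3 L) => Matrix.of fun (i j : Fin (fundamentalLatticeRep 2).N) => ((coords V (ee, i, j, false) : ℝ) : ℂ) + ((coords V (ee, i, j, true) : ℝ) : ℂ) * Complex.I) q.1)) q.2.1 q.2.2.1) else 0) * fderiv ℝ w (coords V) (fun q : Edge 3 L × Fin (fundamentalLatticeRep 2).N × Fin (fundamentalLatticeRep 2).N × Bool => if n.1 = q.1 then (fun z : ℂ => if q.2.2.2 then z.im else z.re) (((Real.sqrt 2 : ℂ) • ((fundamentalLatticeRep 2).lieProj (noiseDir n.2) * (fun (ee : Edge 3 L) => Matrix.of fun (i j : Fin (fundamentalLatticeRep 2).N)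 => ((coords V (ee, i, j, false) : ℝ) : ℂ) + ((coords V (ee, i, j, true) : ℝ) : ℂ) * Complex.I) q.1)) q.2.1 q.2.2.1) else 0) := by
  intro coords A
  classical
  set x : (Edge 3 L × Fin 2 × Fin 2 × Bool → ℝ) := coords V with hx
  set Q : MatrixConfig 3 L (fundamentalLatticeRep 2).N := matrixConfig (fundamentalRep (Fin 2)) V with hQ
  set σ : (Edge 3 L × Fin 2 × Fin 2 × Bool) → (Edge 3 L × NoiseIdx 2) → ℝ := fun i n =>
    if n.1 = i.1 then (fun z : ℂ => if i.2.2.2 then z.im else z.re)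
      ((latticeLangevinDynamics (fundamentalLatticeRep 2) β').noise Q i.1 n.2 i.2.1 i.2.2.1) else 0 with hσ
  have hAV : ∀ i j, A V i j = ∑ n, σ i n * σ j n := fun i j => rfl
  simp_rw [hAV]
  rw [sum_sum_mul_mul_noiseCov_eq_sum_mul (fun i => fderiv ℝ u x (Pi.single i 1)) (fun j => fderiv ℝ w x (Pi.single j 1)) σ]
  have hreb : (fun (ee : Edge 3 L) => Matrix.of fun (i j : Fin (fundamentalLatticeRep 2).N) => ((x (ee, i, j, false) : ℝ) : ℂ) + ((x (ee, i, j, true) : ℝ) : ℂ) * Complex.I) = fun ee => Q ee :=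
    (rebuild_coords_of V).trans (by funext ee; ext a b; rfl)
  have hσn : ∀ n : Edge 3 L × NoiseIdx (fundamentalLatticeRep 2).N, (fun i => σ i n) = (fun q : Edge 3 L × Fin (fundamentalLatticeRep 2).N × Fin (fundamentalLatticeRep 2).N × Bool => if n.1 = q.1 then (fun z : ℂ => if q.2.2.2 then z.im else z.re) (((Real.sqrt 2 : ℂ) • ((fundamentalLatticeRep 2).lieProj (noiseDir n.2) * (fun (ee : Edge 3 L) => Matrix.of fun (i j : Fin (fundamentalLatticeRep 2).N) => ((x (ee, i, j, false) : ℝ) : ℂ) + ((x (ee, i, j, true) : ℝ) : ℂ) * Complex.I) q.1)) q.2.1 q.2.2.1) else 0) := by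
    intro n; funext i
    rw [hreb]
    simp only [hσ, latticeLangevinDynamics_noise]
  change ∑ n : Edge 3 L × NoiseIdx (fundamentalLatticeRep 2).N, _ = _
  refine Finset.sum_congr rfl fun n _ => ?_
  rw [sum_apply_single_mul_eq_apply (fderiv ℝ u x) (fun i => σ i n), sum_apply_single_mul_eq_apply (fderiv ℝ w x) (fun i => σ i n), hσn n]

end Summit.QuantumFields.YangMills.Theorems.ColdStartUniversality
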